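import Summits.QuantumFields.YangMills.Theorems.BalabanUVNodesN22KernelLimitOfActivitySlots

/-!
# NODE N22 (NE9) — THE (1.21)-EXISTENCE HALF ON THE SOFT ROAD, ONE RUNG DOWN: the displayed cross-volume law (S≈) of the scalar KERNELS follows from a VALUE-LEVEL law
# (G≈) on the small-domain TWO-POINT COMPLEX GENERATING FUNCTIONS, by Cauchy on the common probe plane

Cell `pub-ymgap`, Track A (HUMAN RULING D-0062), WIDTH SEAT `dag-n22-w3` g4 on node n22 = NE9; `--kind proof --supports stmt-QuantumFields-20544 --as helper` (K3⁷
`SpineGivenEndpointR13SepCoPH`, skeleton v5 941dddb108cbaacf), COUNT-NEUTRAL.  CLAIM-1 of this seat (pub-ymgap INBOX l.31303, R455 (A) ∕ R461 (A); self-located on a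
WIDTH-CLOSED row, in this seat's own lineage = the EXISTENCE half, dag-lead DEDUP-380 ∕ DEDUP-386 (5)).

WHAT IT REFINES.  This seat's g3 files (`…N22KernelLimitOfActivitySlots` p607522 §1∕§2, carried verbatim by `…N22AtKernelsOfActivitySlotsClosed` p611742 §§1–3 and by
dag-n22-w5's `…N22AtRecordOfPrintedSlotsClosed`) DISPLAY one structural law, (S≈): «the partial sums, over the small∕near domains `lo k K`, of def-B's scalar KERNELS
`polScalar` of the (2.13) terms at the window sites of the tori `K`, `K + 1` are `C r₀^K`-close from a threshold on» — a SECOND-DERIVATIVE-level hypothesis (each `polScalar` is a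
mixed second Fréchet derivative of a term chart at `B = 0`, [I] (1.20)).  Print's currency is one rung lower: [I] p. 264 «Now we take a limit of these functions as
T^{(j+1)} ↗ Z^d. This limit exists by the localized representation (1.7)» — convergence of FUNCTIONS, every derivative bound of [I]∕[II] being a sup bound on an analyticity
domain followed by a Cauchy estimate (p. 264 «uniformly bounded … together with all derivatives»).  This file types that rung:

* (G≈) «CROSS-VOLUME GEOMETRIC CLOSENESS OF THE SMALL-DOMAIN TWO-POINT COMPLEX GENERATING FUNCTIONS»: for `g ∈ W`, a level `k`, a pair of directions∕window sites `(μ, z), (ν, 0)`,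
  from a threshold on and for every colour `c`, the functions `σ ↦ Σ_{X ∈ lo k K} E^{(k+1)}_X(hist; Φ_{K,X}(σ₀·ι_{K,X}e_{μ,z,c} + σ₁·ι_{K,X}e_{ν,0,c}))` of `σ ∈ ℂ²` at run
  lengths `K + 1` and `K` differ by at most `C r₀^K` on the fixed bidisc `‖σ‖ < r₂`, `(2B₃ + 1) r₂ ≤ r` (`Φ_{K,X}`, `ι_{K,X}` = the complexified probe readings of the activity-slot
  road, `e_{μ,t,c} = δ_μ δ_t bV c` the one-bond probe directions; at REAL `σ` the function is chart-free: `Σ_X E_X(hist; emb (exp ρ(σ₀e₁ + σ₁e₂)))` by the chart clause, and its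
  holomorphic extension to the bidisc is unique).
* ★★ `approxStable_of_twoPointGenerating`: (G≈) ⟹ (S≈) VERBATIM (the `hS` binder of p607522 ∕ p611742), with constant `16·max(C,0)∕r₂²`, under the activity-slot road's own
  term-holomorphy inputs (W1's (2.38) value slot + Road-1 numerals + activity holomorphy through `Φ` — dag-n22-c J30-v1.1's parametric Kotecký–Preiss engine
  `differentiableOn_and_norm_clusterStepE_comp_le_of_activityHol` BY NAME gives every term `z ↦ E_X(hist; Φ z)` holomorphic on `U`), the chart clause and the site-weight tails.
  MECHANISM (§0–§1): the two volumes' probe spaces DIFFER (sites of the torus `K` vs `K + 1`), so J28's one-space Cauchy bound for a difference does not apply directly; but each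
  kernel is the mixed second derivative of the TWO-POINT RESTRICTION `p ↦ f(p₀E₁ + p₁E₂)` of its chart (§0 `fderiv_fderiv_eq_polTensor_twoPoint`, chain rule twice), all of which
  live on ONE plane `Unit → Fin 2 → ℝ`; there the small partial sum of colour-diagonal components IS `polTensor` of `Re g_c ∘ ι₂` for the generating function `g_c` (§1
  `sum_polComp_eq_polTensor_twoPointGenerating`, additivity of (1.20) = J27 `polTensor_finset_sum`), `g_c` is holomorphic on the bidisc (§1 `differentiableOn_twoPointGenerating`),
  and J28's `abs_polTensor_sub_le_of_holomorphic` on the plane bounds the colour average of the difference by `16η∕r₂²` (§1 `abs_avg_polTensor_twoPoint_sub_le`).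
* SEQUEL FILE (split for the 400-line rule; v1.1 erratum, ref-O g9 READ-245 NIT «header ∕ content mismatch»): ★★★ `polLimitsExist_localizedSum_of_twoPointGenerating` ∕
  `polLimitsExistOfRecord₁₃_of_twoPointGenerating` (p607522 §1∕§2 with (S≈) ↦ (G≈)), the (G≈)-keyed row sentences of p611742 and the A6 termless-tower witness
  `polLimitsExist_localizedSum_of_twoPointGenerating_fires_zeroTower` are typed in `…N22KernelLimitOfTwoPointGeneratingLetters` (p616912), NOT in this file — THIS file ends at §2 with
  seven theorems.  The NON-degenerate A6 rung for the EXISTENCE half (nonzero terms whose (1.21) limits exist with content) needs CROSS-VOLUME-COHERENT model towers — an identification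
  of the small domains of the tori `K`, `K + 1` near the window — which the tree does not have; said, not hidden (dag-n22-w2's `NonzeroChart` model and dag-n22-w1's phase towers are
  single-volume objects serving the activity-level letters).  Further sequels (chart-free real-probe law (G≈ℝ)): `…N22KernelLimitOfRealTwoPoint` (p618762) ∕ `…RealTwoPointLetters`
  (p619896) ∕ `…RealTwoPointRecord` (p620925).

CONSUMES BY NAME (nothing re-declared): this seat's p607522 `polLimitsExist_localizedSum_of_activitySlots` ∕ `kappa_four_smoke`; dag-n22-c J30-v1.1
`differentiableOn_and_norm_clusterStepE_comp_le_of_activityHol` (p602155), J28 `contDiffAt_two_of_holomorphic` ∕ `abs_polTensor_sub_le_of_holomorphic` (p596444), J27 `polTensor_finset_sum`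
(p594958); node00-def-W1 W1-19b `PolLimitsExist` ∕ `PolLimitsExistOfRecord₁₃` ∕ `polLimitsExistOfRecord₁₃_iff_of_localizes`, W1-20 `localizedSum` ∕ `Localizes17OfRecord₁₃`, W1 `ClusterStep.{E, H,
Bound238}`; def-B `polScalar` ∕ `polComp` ∕ `polTensor` ∕ `expChart`; dag-n23-b `polScalar_zeroChart`; Mathlib calculus (`fderiv_comp`, `ContinuousLinearMap.compL`).

HONEST FRAMING (binding).  Count-neutral helper; THEOREMS ONLY (0 def, 0 sorry, standard axioms); one elementary identity + one Cauchy estimate + two compositions.  (G≈) is a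
DISPLAYED HYPOTHESIS with its owner (NODE A ∕ def-W1: the thermodynamic convergence, near the window, of the local terms' generating functions — what (1.7)-locality of the terms
together with the p. 282 tails of the readings `Φ_K` would give; NOT typed here), as are W1's (2.38) value slot at the towers of record (N10's Lemma 3 T-row ∕ NODE A), activity
holomorphy through the complexified minimizer reading and the reading itself ([I] p. 264, [II] p. 15 — NODE A), the p. 282 site-weight tails (NODE A), W1-20's law
`Localizes17OfRecord₁₃` (NODE A ∕ N10), Road-1 numerals.  (1.21)'s existence for the terms OF RECORD is NOT proved; nothing of Bałaban's is constructed or asserted; no inhabitant at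
the datum of record; N22 NOT discharged (typed 28∕28 · discharged 5∕27 UNMOVED); K3⁷ OPEN, NOT claimed; no count claim (the chair's single count line is the only count); one finite
𝕋⁴ programme at fixed ε — R4 closes the CONDITIONAL rung `BalabanLadder.UV` only; NOTHING about the continuum limit, ℝ⁴, infinite volume, OS axioms, a mass gap or the Clay problem
is proved or claimed by any of this.  The ledger cite list is EMPTY (Summit side); the `[cite: …]` brackets in the theorem docstrings are TYPE locators only (v1.1 wording, ref-O
READ-245 NIT): [I] = [Balaban1987RG1] (1.7) p. 261, (1.18) p. 263, (1.20)–(1.21) p. 264, p. 282; [II] = [Balaban1988RG2Cluster] (2.13)–(2.14) pp. 14–15, Lemma 3 (2.38) p. 20; [Chae1985]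
Ch. 15 (Cauchy estimates in Banach spaces).  v1.1 (docstring-only; every declaration byte-identical): `hδ₀ : 0 < δ₀` of §2 is used only as `0 ≤ δ₀` (READ-245 NIT, kept for the consumers'
signatures).
-/

noncomputable section

open Filter Topology Metric Set
open scoped BigOperators

namespace YMDAG.N22.AtKernels

open Literature.MathematicalPhysics.QuantumFieldTheory.Balaban1983to89
open Literature.MathematicalPhysics.QuantumFieldTheory.Balaban1983to89.T4Continuum (T4Family)
open Literature.MathematicalPhysics.QuantumFieldTheory.Balaban1983to89.T4OutputRate (Window)
open Literature.MathematicalPhysics.QuantumFieldTheory.Balaban1983to89.B12PolarizationTensor120 (polTensor polComp expChart)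
open Literature.MathematicalPhysics.QuantumFieldTheory.Balaban1983to89.Node00 (polScalar polWindow siteOfInt PolLimitExists Stage13Params MatA)
open Literature.MathematicalPhysics.QuantumFieldTheory.Balaban1983to89.Node00.Sect2 (domCount domSys CPair)
open Literature.MathematicalPhysics.QuantumFieldTheory.Balaban1983to89.Node00.W1 (ClusterTower ClusterStep)
open Literature.MathematicalPhysics.QuantumFieldTheory.Balaban1983to89.Node00.LocalizedSum17 (localizedSum ReadingMaps Localizes17OfRecord₁₃)
open Literature.MathematicalPhysics.QuantumFieldTheory.Balaban1983to89.Node00.U3OfKernels (histPrefix)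
open Literature.MathematicalPhysics.QuantumFieldTheory.Balaban1983to89.Node00.U3KernelLetters (PolLimitsExist PolLimitsExistOfRecord₁₃ polLimitsExistOfRecord₁₃_iff_of_localizes)
open Literature.MathematicalPhysics.QuantumFieldTheory.Balaban1983to89.B12Decay510Torus (distCT nearT distCT_nonneg)
open Literature.MathematicalPhysics.QuantumFieldTheory.Balaban1983to89.B12TreeDecay (K₀ kappa₀ K₀_pos kappa₀_nonneg)
open Literature.MathematicalPhysics.QuantumFieldTheory.Balaban1983to89.TreeLengthTorus (TPt torusTreeLen torusTreeLen_nonneg)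
open YMDAG.N22.WindowOfLocalTerms (contDiffAt_two_of_holomorphic abs_polTensor_sub_le_of_holomorphic polTensor_finset_sum
  differentiableOn_and_norm_clusterStepE_comp_le_of_activityHol)

/-! ## §0 The two-point restriction identity (chain rule twice through `p ↦ p₀E₁ + p₁E₂`) -/

section TwoPoint

variable {P F' : Type*} [NormedAddCommGroup P] [NormedSpace ℝ P] [NormedAddCommGroup F'] [NormedSpace ℝ F']

/-- **THE TWO-POINT RESTRICTION IDENTITY.**  For a functional `f` twice continuously differentiable at `0` and two directions `E₁, E₂`, the second derivative `D²f(0)(E₁, E₂)` IS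
the polarization tensor (1.20) — taken on the probe plane `Unit → Fin 2 → ℝ` at its two coordinate bonds — of the TWO-POINT RESTRICTION `p ↦ f(p₀E₁ + p₁E₂)` (the chain rule twice
through the continuous linear map `L p = p₀E₁ + p₁E₂`: near `0`, `D(f∘L)(p) = Df(Lp)∘L`, whence `D²(f∘L)(0)(h₁, h₂) = D²f(0)(Lh₁, Lh₂)`, and `Lδ₀ = E₁`, `Lδ₁ = E₂`). [folklore] -/
theorem fderiv_fderiv_eq_polTensor_twoPoint {f : P → F'} (hf : ContDiffAt ℝ 2 f 0) (E₁ E₂ : P) :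
    fderiv ℝ (fderiv ℝ f) 0 E₁ E₂ =
      polTensor ℝ (fun p : Unit → Fin 2 → ℝ => f (p () 0 • E₁ + p () 1 • E₂)) () 0 1 () 1 1 := by
  let c₀ : (Unit → Fin 2 → ℝ) →L[ℝ] ℝ := (ContinuousLinearMap.proj (0 : Fin 2)).comp (ContinuousLinearMap.proj (R := ℝ) (φ := fun _ : Unit => Fin 2 → ℝ) ())
  let c₁ : (Unit → Fin 2 → ℝ) →L[ℝ] ℝ := (ContinuousLinearMap.proj (1 : Fin 2)).comp (ContinuousLinearMap.proj (R := ℝ) (φ := fun _ : Unit => Fin 2 → ℝ) ())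
  let L : (Unit → Fin 2 → ℝ) →L[ℝ] P := c₀.smulRight E₁ + c₁.smulRight E₂
  have hL : ∀ p : Unit → Fin 2 → ℝ, L p = p () 0 • E₁ + p () 1 • E₂ := fun p => rfl
  have hfL : (fun p : Unit → Fin 2 → ℝ => f (p () 0 • E₁ + p () 1 • E₂)) = f ∘ L := funext fun p => by rw [Function.comp_apply, hL]
  have hL0 : L 0 = 0 := map_zero L
  rw [B12PolarizationTensor120.polTensor_def, hfL]
  -- near `0` the composite is differentiable with `D(f∘L)(p) = Df(Lp)∘L`
  have hdiff : ∀ᶠ y in 𝓝 (0 : P), DifferentiableAt ℝ f y :=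
    (hf.eventually (by simp)).mono fun y hy => hy.differentiableAt (by simp)
  have hdiffL : ∀ᶠ p in 𝓝 (0 : Unit → Fin 2 → ℝ), DifferentiableAt ℝ f (L p) := by
    have hT : Tendsto L (𝓝 0) (𝓝 (L 0)) := L.continuous.tendsto 0
    rw [hL0] at hT
    exact hT.eventually hdiff
  have h1 : fderiv ℝ (f ∘ L) =ᶠ[𝓝 0] fun p => (fderiv ℝ f (L p)).comp L :=
    hdiffL.mono fun p hp => by rw [fderiv_comp p hp L.differentiableAt, L.fderiv]
  rw [h1.fderiv_eq]
  -- `p ↦ Df(Lp)∘L` = (precomposition by `L`) ∘ `Df` ∘ `L`, differentiated at `0`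
  have h2 : HasFDerivAt (fderiv ℝ f) (fderiv ℝ (fderiv ℝ f) 0) (L 0) := by
    rw [hL0]; exact ((hf.fderiv_right (m := 1) le_rfl).differentiableAt one_ne_zero).hasFDerivAt
  have h3 : HasFDerivAt (fun p => fderiv ℝ f (L p)) ((fderiv ℝ (fderiv ℝ f) 0).comp L) 0 := h2.comp 0 L.hasFDerivAt
  have h4 : HasFDerivAt (fun p => (fderiv ℝ f (L p)).comp L)
      (((ContinuousLinearMap.compL ℝ (Unit → Fin 2 → ℝ) P F').flip L).comp ((fderiv ℝ (fderiv ℝ f) 0).comp L)) 0 :=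
    ((ContinuousLinearMap.compL ℝ (Unit → Fin 2 → ℝ) P F').flip L).hasFDerivAt.comp 0 h3
  rw [h4.fderiv]
  simp only [ContinuousLinearMap.comp_apply, ContinuousLinearMap.flip_apply, ContinuousLinearMap.compL_apply, hL]
  simp

/-- The two-point restriction of a functional `C^n` at `0` is `C^n` at `0` (the restriction map `p ↦ p₀E₁ + p₁E₂` is smooth and fixes `0`). [folklore] -/
theorem contDiffAt_twoPoint {f : P → F'} {n : WithTop ℕ∞} (hf : ContDiffAt ℝ n f 0) (E₁ E₂ : P) :
    ContDiffAt ℝ n (fun p : Unit → Fin 2 → ℝ => f (p () 0 • E₁ + p () 1 • E₂)) 0 := by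
  have hmap : ContDiff ℝ n (fun p : Unit → Fin 2 → ℝ => p () 0 • E₁ + p () 1 • E₂) :=
    ((contDiff_apply_apply ℝ ℝ () (0 : Fin 2)).smul contDiff_const).add ((contDiff_apply_apply ℝ ℝ () (1 : Fin 2)).smul contDiff_const)
  have h0 : (fun p : Unit → Fin 2 → ℝ => p () 0 • E₁ + p () 1 • E₂) 0 = 0 := by simp
  have hf' : ContDiffAt ℝ n f ((fun p : Unit → Fin 2 → ℝ => p () 0 • E₁ + p () 1 • E₂) 0) := by rw [h0]; exact hf
  exact hf'.comp 0 hmap.contDiffAt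

end TwoPoint

/-! ## §1 One volume: the small partial sum of def-B's kernels IS the mixed second derivative of the two-point complex generating function; two volumes compared on the common plane -/

section Generating

variable {𝔄 : Type*} [NormedRing 𝔄] [NormedAlgebra ℝ 𝔄] {V : Type*} [NormedAddCommGroup V] [NormedSpace ℝ V] {ι : Type*} [Fintype ι]
  {Λ T : Type*} [Fintype Λ] [Fintype T] [DecidableEq Λ] [DecidableEq T] {𝒳 : Type*} {Ec : Type*} [NormedAddCommGroup Ec] [NormedSpace ℂ Ec]

omit [Fintype ι] in
/-- **ONE VOLUME: THE PARTIAL SUM OF COLOUR-DIAGONAL KERNEL COMPONENTS IS `polTensor` OF THE TWO-POINT GENERATING FUNCTION.**  For a finite family of (1.7) terms `ℰ_X` read in def-B's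
exponential chart, each the real part of a function `G_X` holomorphic on an open `U_X ∋ 0` of a complex normed space through a real-linear `ι_X` (`ℰ_X(exp ρB) = Re G_X(ι_X B)` — the
complexified reading of [I] p. 264 ∕ [II] p. 15), and one colour `c`: `Σ_X Π^{cc}_{ℰ_X,μν}(x, y)` is the polarization tensor, at the two coordinate bonds of the probe plane, of the real
part of the TWO-POINT COMPLEX GENERATING FUNCTION `σ ↦ Σ_X G_X(σ₀·ι_X e_{μ,x,c} + σ₁·ι_X e_{ν,y,c})` along the plane's complexification (§0 per term — every chart is `C²` at `0` by J28
`contDiffAt_two_of_holomorphic` — then J27's additivity `polTensor_finset_sum`; real-linearity of `ι_X` and `(p : ℂ) • v = p • v`). [cite: Balaban1987RG1, (1.7) p.261 and (1.20)-(1.21) p.264] -/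
theorem sum_polComp_eq_polTensor_twoPointGenerating (s : Finset 𝒳) (ℰ : 𝒳 → (Λ → T → 𝔄) → ℝ) (ρ : V →L[ℝ] 𝔄) (bV : Module.Basis ι ℝ V)
    (G : 𝒳 → Ec → ℂ) (U : 𝒳 → Set Ec) (ιc : 𝒳 → ((Λ → T → V) →L[ℝ] Ec)) (hU : ∀ X ∈ s, IsOpen (U X)) (h0U : ∀ X ∈ s, (0 : Ec) ∈ U X)
    (hG : ∀ X ∈ s, DifferentiableOn ℂ (G X) (U X)) (hf : ∀ X ∈ s, ∀ B, expChart (ℰ X) ρ B = (G X (ιc X B)).re)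
    (μ : Λ) (x : T) (ν : Λ) (y : T) (c : ι) :
    ∑ X ∈ s, polComp ℝ (expChart (ℰ X) ρ) bV μ x c ν y c =
      polTensor ℝ (fun p : Unit → Fin 2 → ℝ =>
        (∑ X ∈ s, G X ((p () 0 : ℂ) • ιc X (Pi.single μ (Pi.single x (bV c))) + (p () 1 : ℂ) • ιc X (Pi.single ν (Pi.single y (bV c))))).re) () 0 1 () 1 1 := by
  set E₁ : Λ → T → V := Pi.single μ (Pi.single x (bV c)) with hE₁
  set E₂ : Λ → T → V := Pi.single ν (Pi.single y (bV c)) with hE₂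
  have hC2 : ∀ X ∈ s, ContDiffAt ℝ 2 (expChart (ℰ X) ρ) 0 := fun X hX => by
    rw [show expChart (ℰ X) ρ = fun B => (G X (ιc X B)).re from funext (hf X hX)]
    exact contDiffAt_two_of_holomorphic _ (hG X hX) (hU X hX) (ιc X) (by rw [map_zero]; exact h0U X hX)
  have hterm : ∀ X ∈ s, polComp ℝ (expChart (ℰ X) ρ) bV μ x c ν y c =
      polTensor ℝ (fun p : Unit → Fin 2 → ℝ => expChart (ℰ X) ρ (p () 0 • E₁ + p () 1 • E₂)) () 0 1 () 1 1 := fun X hX => by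
    rw [polComp, B12PolarizationTensor120.polTensor_def]
    exact fderiv_fderiv_eq_polTensor_twoPoint (hC2 X hX) E₁ E₂
  rw [Finset.sum_congr rfl hterm, ← polTensor_finset_sum ℝ s _ (fun X hX => contDiffAt_twoPoint (hC2 X hX) E₁ E₂)]
  congr 1
  funext p
  rw [Complex.re_sum]
  refine Finset.sum_congr rfl fun X hX => ?_
  rw [hf X hX, map_add, map_smul, map_smul, ← Complex.coe_smul, ← Complex.coe_smul]

omit [NormedAddCommGroup V] [NormedSpace ℝ V] [Fintype Λ] [Fintype T] [DecidableEq Λ] [DecidableEq T] in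
/-- **THE TWO-POINT COMPLEX GENERATING FUNCTION IS HOLOMORPHIC ON THE BIDISC** `‖σ‖ < r₂`: every `G_X` holomorphic on `U_X ⊇ ball 0 r`, both directions of `norm ≤ N` (`N ≥ 0`) and
`(2N + 1) r₂ ≤ r` (the ℂ-affine maps `σ ↦ σ₀a_X + σ₁b_X` carry the bidisc into `ball 0 r`). [cite: Balaban1987RG1, (1.20)-(1.21) p.264 (bookkeeping)] -/
theorem differentiableOn_twoPointGenerating (s : Finset 𝒳) (G : 𝒳 → Ec → ℂ) (U : 𝒳 → Set Ec) (a b : 𝒳 → Ec) {r r₂ N : ℝ}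
    (hN : 0 ≤ N) (hr₂ : 0 < r₂) (hNr : (2 * N + 1) * r₂ ≤ r) (hrU : ∀ X ∈ s, ball (0 : Ec) r ⊆ U X)
    (hG : ∀ X ∈ s, DifferentiableOn ℂ (G X) (U X)) (ha : ∀ X ∈ s, ‖a X‖ ≤ N) (hb : ∀ X ∈ s, ‖b X‖ ≤ N) :
    DifferentiableOn ℂ (fun σ : Fin 2 → ℂ => ∑ X ∈ s, G X (σ 0 • a X + σ 1 • b X)) (ball 0 r₂) := by
  refine DifferentiableOn.fun_sum (u := s) (A := fun X (σ : Fin 2 → ℂ) => G X (σ 0 • a X + σ 1 • b X)) fun X hX => ?_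
  have hmaps : MapsTo (fun σ : Fin 2 → ℂ => σ 0 • a X + σ 1 • b X) (ball 0 r₂) (U X) := by
    intro σ hσ
    refine hrU X hX (mem_ball_zero_iff.2 ?_)
    rw [mem_ball_zero_iff] at hσ
    have h0 : ‖σ 0‖ ≤ ‖σ‖ := norm_le_pi_norm σ 0
    have h1 : ‖σ 1‖ ≤ ‖σ‖ := norm_le_pi_norm σ 1
    calc ‖σ 0 • a X + σ 1 • b X‖ ≤ ‖σ 0 • a X‖ + ‖σ 1 • b X‖ := norm_add_le _ _
      _ = ‖σ 0‖ * ‖a X‖ + ‖σ 1‖ * ‖b X‖ := by rw [norm_smul, norm_smul]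
      _ ≤ ‖σ‖ * N + ‖σ‖ * N := add_le_add (mul_le_mul h0 (ha X hX) (norm_nonneg _) (norm_nonneg _)) (mul_le_mul h1 (hb X hX) (norm_nonneg _) (norm_nonneg _))
      _ = 2 * N * ‖σ‖ := by ring
      _ < r := by nlinarith [norm_nonneg σ]
  exact (hG X hX).comp (((differentiable_apply 0).smul_const (a X)).add ((differentiable_apply 1).smul_const (b X))).differentiableOn hmaps

/-- **ONE VOLUME, def-B's SCALAR KERNEL** (the normalised colour trace): with `g c` the two-point complex generating function of colour `c` (displayed by the equation `hg`),
`Σ_X Π_{ℰ_X,μν}(x, y) = |ι|⁻¹ Σ_c polTensor(Re (g c) ∘ ι₂)(δ₀, δ₁)` — the previous identity averaged over the colour basis. [cite: Balaban1987RG1, (1.7) p.261 and (1.20)-(1.21) p.264] -/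
theorem sum_polScalar_eq_avg_polTensor_twoPointGenerating (s : Finset 𝒳) (ℰ : 𝒳 → (Λ → T → 𝔄) → ℝ) (ρ : V →L[ℝ] 𝔄) (bV : Module.Basis ι ℝ V)
    (G : 𝒳 → Ec → ℂ) (U : 𝒳 → Set Ec) (ιc : 𝒳 → ((Λ → T → V) →L[ℝ] Ec)) (hU : ∀ X ∈ s, IsOpen (U X)) (h0U : ∀ X ∈ s, (0 : Ec) ∈ U X)
    (hG : ∀ X ∈ s, DifferentiableOn ℂ (G X) (U X)) (hf : ∀ X ∈ s, ∀ B, expChart (ℰ X) ρ B = (G X (ιc X B)).re)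
    (μ : Λ) (x : T) (ν : Λ) (y : T) (g : ι → (Fin 2 → ℂ) → ℂ)
    (hg : ∀ c σ, g c σ = ∑ X ∈ s, G X (σ 0 • ιc X (Pi.single μ (Pi.single x (bV c))) + σ 1 • ιc X (Pi.single ν (Pi.single y (bV c))))) :
    ∑ X ∈ s, polScalar (ℰ X) ρ bV μ x ν y =
      (Fintype.card ι : ℝ)⁻¹ * ∑ c, polTensor ℝ (fun p : Unit → Fin 2 → ℝ => (g c (fun i => (p () i : ℂ))).re) () 0 1 () 1 1 := by
  simp only [polScalar]
  rw [← Finset.mul_sum, Finset.sum_comm]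
  congr 1
  refine Finset.sum_congr rfl fun c _ => ?_
  rw [sum_polComp_eq_polTensor_twoPointGenerating s ℰ ρ bV G U ιc hU h0U hG hf μ x ν y c]
  congr 1
  funext p
  simp only [hg]

omit [NormedAddCommGroup V] [NormedSpace ℝ V] [Fintype Λ] [Fintype T] [DecidableEq Λ] [DecidableEq T] [NormedAddCommGroup Ec] [NormedSpace ℂ Ec] in
/-- **TWO VOLUMES COMPARED ON THE COMMON PLANE.**  Colour by colour, let the kernel partial sums of two volumes be the polarization tensors (at the coordinate bonds of the probe plane)
of the real parts of two-point complex generating functions `g_A c`, `g_B c` holomorphic on the bidisc `‖σ‖ < r₂` with `‖g_A c − g_B c‖ ≤ η` there (`η ≥ 0`).  Then the colour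
AVERAGES differ by at most `16 η ∕ r₂²` — module J28's Cauchy bound `abs_polTensor_sub_le_of_holomorphic` for the DIFFERENCE on the plane (the plane's two bond directions have
complexified norm `≤ 1`). [cite: Balaban1987RG1, (1.20)-(1.21) p.264] [cite: Chae1985, Ch. 15 (Cauchy estimates)] -/
theorem abs_avg_polTensor_twoPoint_sub_le (gA gB : ι → (Fin 2 → ℂ) → ℂ) {r₂ η : ℝ} (hr₂ : 0 < r₂) (hη : 0 ≤ η)
    (hgA : ∀ c, DifferentiableOn ℂ (gA c) (ball 0 r₂)) (hgB : ∀ c, DifferentiableOn ℂ (gB c) (ball 0 r₂))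
    (hclose : ∀ c, ∀ σ ∈ ball (0 : Fin 2 → ℂ) r₂, ‖gA c σ - gB c σ‖ ≤ η) :
    |(Fintype.card ι : ℝ)⁻¹ * ∑ c, polTensor ℝ (fun p : Unit → Fin 2 → ℝ => (gA c (fun i => (p () i : ℂ))).re) () 0 1 () 1 1 -
      (Fintype.card ι : ℝ)⁻¹ * ∑ c, polTensor ℝ (fun p : Unit → Fin 2 → ℝ => (gB c (fun i => (p () i : ℂ))).re) () 0 1 () 1 1| ≤ 16 * η / r₂ ^ 2 := by
  -- the complexification of the probe plane
  let ι₂ : (Unit → Fin 2 → ℝ) →L[ℝ] (Fin 2 → ℂ) :=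
    ContinuousLinearMap.pi fun i => Complex.ofRealCLM.comp ((ContinuousLinearMap.proj i).comp (ContinuousLinearMap.proj (R := ℝ) (φ := fun _ : Unit => Fin 2 → ℝ) ()))
  have hι₂ : ∀ p : Unit → Fin 2 → ℝ, ι₂ p = fun i => (p () i : ℂ) := fun p => rfl
  have hnorm : ∀ j : Fin 2, ‖ι₂ (Pi.single () (Pi.single j (1 : ℝ)))‖ ≤ 1 := fun j => by
    rw [hι₂, pi_norm_le_iff_of_nonneg zero_le_one]
    intro i
    by_cases hij : i = j
    · subst hij; simp
    · simp [hij]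
  have hcol : ∀ c, |polTensor ℝ (fun p : Unit → Fin 2 → ℝ => (gA c (fun i => (p () i : ℂ))).re) () 0 1 () 1 1 -
      polTensor ℝ (fun p : Unit → Fin 2 → ℝ => (gB c (fun i => (p () i : ℂ))).re) () 0 1 () 1 1| ≤ 16 * η / r₂ ^ 2 := by
    intro c
    have h := abs_polTensor_sub_le_of_holomorphic (gA c) (gB c) (hgA c) (hgB c) isOpen_ball hr₂ subset_rfl (hclose c) ι₂
      (fun p => (gA c (fun i => (p () i : ℂ))).re) (fun p => (gB c (fun i => (p () i : ℂ))).re) (fun B => by rw [hι₂]) (fun B => by rw [hι₂])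
      () (0 : Fin 2) (1 : ℝ) () (1 : Fin 2) (1 : ℝ)
    refine h.trans ?_
    have h16 : 0 ≤ 16 * η / r₂ ^ 2 := by positivity
    calc 16 * η / r₂ ^ 2 * ‖ι₂ (Pi.single () (Pi.single 0 1))‖ * ‖ι₂ (Pi.single () (Pi.single 1 1))‖
        ≤ 16 * η / r₂ ^ 2 * 1 * 1 := mul_le_mul (mul_le_mul_of_nonneg_left (hnorm 0) h16) (hnorm 1) (norm_nonneg _) (by positivity)
      _ = 16 * η / r₂ ^ 2 := by ring
  rw [← mul_sub, ← Finset.sum_sub_distrib, abs_mul, abs_inv, Nat.abs_cast]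
  rcases Nat.eq_zero_or_pos (Fintype.card ι) with h0 | hpos
  · rw [h0, Nat.cast_zero, inv_zero, zero_mul]; positivity
  · calc (Fintype.card ι : ℝ)⁻¹ * |∑ c, (polTensor ℝ (fun p : Unit → Fin 2 → ℝ => (gA c (fun i => (p () i : ℂ))).re) () 0 1 () 1 1 -
          polTensor ℝ (fun p : Unit → Fin 2 → ℝ => (gB c (fun i => (p () i : ℂ))).re) () 0 1 () 1 1)|
        ≤ (Fintype.card ι : ℝ)⁻¹ * ∑ c : ι, 16 * η / r₂ ^ 2 :=
          mul_le_mul_of_nonneg_left ((Finset.abs_sum_le_sum_abs _ _).trans (Finset.sum_le_sum fun c _ => hcol c)) (by positivity)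
      _ = 16 * η / r₂ ^ 2 := by
          rw [Finset.sum_const, Finset.card_univ, nsmul_eq_mul, ← mul_assoc, inv_mul_cancel₀ (by exact_mod_cast hpos.ne'), one_mul]

end Generating

/-! ## §2 In the towers: the value-level law (G≈) gives the kernel-level law (S≈) of p607522 ∕ p611742 VERBATIM -/

section Towers

variable {𝔄 : Type*} [NormedRing 𝔄] [NormedAlgebra ℝ 𝔄] {𝔸 : Type*}
variable {V : Type*} [NormedAddCommGroup V] [NormedSpace ℝ V] {ι : Type*} [Fintype ι]
variable (F : T4Family)

open Classical in
/-- ★★ **(G≈) ⟹ (S≈): THE KERNEL-LEVEL CROSS-VOLUME LAW FROM THE VALUE-LEVEL ONE.**  In the setting of `polLimitsExist_localizedSum_of_activitySlots` (towers `S`, reading maps `emb`,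
probe `ρ`, basis `bV`, window `W`; W1's (2.38) value slot on prefix sets `Wk K k ∋ (g_0,…,g_k)` with Road-1 numerals `A ≥ 0`, `0 ≤ r₁`, `r₁ + 128 log 162 + 2 ≤ R`,
`A e^{5r₁+1}K₀(64,8)·9·64 ≤ 1`; per-term complexified readings `Φ K k X` on open `U K k X ⊇ ball 0 r` through real-linear `ιc K k X` with the chart clause `Φ(ιc B) = emb(exp ρB)`, the
space clause and activity holomorphy on `U`; site weights `‖ιc e_{l,t,c}‖ ≤ w ≤ B₃ e^{−δ₀ dist}`, `B₃ ≥ 0`, `δ₀ > 0`; a small∕near class `lo k K`), IF (G≈): for every `g ∈ W`,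
level `k` and `(μ, ν, z)` there are `K₀, C` with, for all `K ≥ K₀`, all colours `c` and all `σ` in the bidisc `‖σ‖ < r₂` (`0 < r₂`, `(2B₃ + 1) r₂ ≤ r`),
`‖Σ_{X ∈ lo k (K+1)} E^{(k+1)}_X(hist; Φ_{K+1,X}(σ₀·ιc e_{μ,z,c} + σ₁·ιc e_{ν,0,c})) − Σ_{X ∈ lo k K} E^{(k+1)}_X(hist; Φ_{K,X}(σ₀·ιc e_{μ,z,c} + σ₁·ιc e_{ν,0,c}))‖ ≤ C r₀^K`
(`0 ≤ r₀`), THEN (S≈) holds: the small-domain partial sums of def-B's scalar kernels at the window sites `(z, 0)` of the tori `K + 1`, `K` are `(16·max(C,0)∕r₂²)·r₀^K`-close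
for `K ≥ K₀`.  Every term `z ↦ E_X(hist; Φ z)` is holomorphic on `U` by dag-n22-c J30-v1.1's engine (from the activity slots); §1 does the rest.
[cite: Balaban1987RG1, (1.7) p.261, (1.20)-(1.21) p.264; Balaban1988RG2Cluster, (2.13)-(2.14) pp.14-15, (2.38) p.20] -/
theorem approxStable_of_twoPointGenerating (M : ℕ) [NeZero M]
    (S : (K : ℕ) → ClusterTower (F.P K) 𝔸 M) (emb : ReadingMaps F 𝔄 𝔸) (ρ : V →L[ℝ] 𝔄) (bV : Module.Basis ι ℝ V) (W : Set (ℕ → ℝ))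
    (Wk : (K k : ℕ) → Set (Fin (k + 1) → ℝ)) (hWk : ∀ g ∈ W, ∀ K k, histPrefix g k ∈ Wk K k)
    (sp : (K k : ℕ) → (domSys (F.P K) M (k + 1)).Dom → Set (CPair (F.P K) 𝔸)) {A R r₁ B₃ δ₀ r r₂ r₀ : ℝ}
    (hA : 0 ≤ A) (hr₁ : 0 ≤ r₁) (hrate : r₁ + 2 * (64 * Real.log 162) + 2 ≤ R)
    (hsmall : A * Real.exp (5 * r₁ + 1) * K₀ 64 8 * 9 * 64 ≤ 1) (hB₃ : 0 ≤ B₃) (hδ₀ : 0 < δ₀) (hr : 0 < r)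
    (h238 : ∀ K k, ((S K) k).Bound238 (Wk K k) (sp K k) A R)
    (Ec : ℕ → ℕ → Type*) [∀ K k, NormedAddCommGroup (Ec K k)] [∀ K k, NormedSpace ℂ (Ec K k)]
    (ιc : (K k : ℕ) → (domSys (F.P K) M (k + 1)).Dom → ((Fin (F.P K).d → Site (F.P K) (k + 1) → V) →L[ℝ] Ec K k))
    (Φ : (K k : ℕ) → (domSys (F.P K) M (k + 1)).Dom → Ec K k → CPair (F.P K) 𝔸)
    (U : (K k : ℕ) → (domSys (F.P K) M (k + 1)).Dom → Set (Ec K k)) (hU : ∀ K k X, IsOpen (U K k X)) (hrU : ∀ K k X, ball (0 : Ec K k) r ⊆ U K k X)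
    (hHhol : ∀ K k, ∀ hist ∈ Wk K k, ∀ (X Z : (domSys (F.P K) M (k + 1)).Dom), Z.1 ⊆ X.1 →
      DifferentiableOn ℂ (fun z => ((S K) k).H hist (Φ K k X z) Z) (U K k X))
    (hΦemb : ∀ K k X (B : Fin (F.P K).d → Site (F.P K) (k + 1) → V), Φ K k X (ιc K k X B) = emb K k (fun l t => NormedSpace.exp (ρ (B l t))))
    (hΦsp : ∀ K k X, ∀ z ∈ U K k X, ∀ Z : (domSys (F.P K) M (k + 1)).Dom, Z.1 ⊆ X.1 → Φ K k X z ∈ sp K k Z)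
    (w : (K k : ℕ) → (domSys (F.P K) M (k + 1)).Dom → Site (F.P K) (k + 1) → ℝ)
    (hw : ∀ K k X (l : Fin (F.P K).d) (t : Site (F.P K) (k + 1)) (c : ι), ‖ιc K k X (Pi.single l (Pi.single t (bV c)))‖ ≤ w K k X t)
    (hwB : ∀ K k (X : (domSys (F.P K) M (k + 1)).Dom) (t : Site (F.P K) (k + 1)),
      w K k X t ≤ B₃ * Real.exp (-δ₀ * distCT (domCount (F.P K) M (k + 1)) M (fun i => (ZMod.cast (t i) : ZMod (domCount (F.P K) M (k + 1) * M)))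
        (nearT (M := M) (fun i => (ZMod.cast (t i) : ZMod (domCount (F.P K) M (k + 1) * M))) X)))
    (lo : (k K : ℕ) → (domSys (F.P K) M (k + 1)).Dom → Prop) [∀ k K, DecidablePred (lo k K)]
    (hr₂ : 0 < r₂) (hr₂r : (2 * B₃ + 1) * r₂ ≤ r) (hr₀' : 0 ≤ r₀)
    (hG : ∀ g ∈ W, ∀ (k : ℕ) (μ ν : Fin 4) (z : Fin 4 → ℤ), ∃ (K₀ : ℕ) (C : ℝ), ∀ K : ℕ, K₀ ≤ K → ∀ (c : ι) (σ : Fin 2 → ℂ), ‖σ‖ < r₂ →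
      ‖∑ X ∈ Finset.univ.filter (lo k (K + 1)), ((S (K + 1)) k).E (histPrefix g k) (Φ (K + 1) k X
          (σ 0 • ιc (K + 1) k X (Pi.single (Fin.cast (F.P_d (K + 1)).symm μ) (Pi.single (siteOfInt F (K + 1) (k + 1) z) (bV c))) +
           σ 1 • ιc (K + 1) k X (Pi.single (Fin.cast (F.P_d (K + 1)).symm ν) (Pi.single (siteOfInt F (K + 1) (k + 1) 0) (bV c))))) X -
        ∑ X ∈ Finset.univ.filter (lo k K), ((S K) k).E (histPrefix g k) (Φ K k X
          (σ 0 • ιc K k X (Pi.single (Fin.cast (F.P_d K).symm μ) (Pi.single (siteOfInt F K (k + 1) z) (bV c))) +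
           σ 1 • ιc K k X (Pi.single (Fin.cast (F.P_d K).symm ν) (Pi.single (siteOfInt F K (k + 1) 0) (bV c))))) X‖ ≤ C * r₀ ^ K) :
    ∀ g ∈ W, ∀ (k : ℕ) (μ ν : Fin 4) (z : Fin 4 → ℤ), ∃ (K₀ : ℕ) (C : ℝ), ∀ K : ℕ, K₀ ≤ K →
      |∑ X ∈ Finset.univ.filter (lo k (K + 1)), polScalar (fun U' => (((S (K + 1)) k).E (histPrefix g k) (emb (K + 1) k U') X).re) ρ bV (Fin.cast (F.P_d (K + 1)).symm μ) (siteOfInt F (K + 1) (k + 1) z) (Fin.cast (F.P_d (K + 1)).symm ν) (siteOfInt F (K + 1) (k + 1) 0) -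
        ∑ X ∈ Finset.univ.filter (lo k K), polScalar (fun U' => (((S K) k).E (histPrefix g k) (emb K k U') X).re) ρ bV (Fin.cast (F.P_d K).symm μ) (siteOfInt F K (k + 1) z) (Fin.cast (F.P_d K).symm ν) (siteOfInt F K (k + 1) 0)| ≤ C * r₀ ^ K := by
  intro g hg k μ ν z
  obtain ⟨K₀, C, hC⟩ := hG g hg k μ ν z
  refine ⟨K₀, 16 * max C 0 / r₂ ^ 2, fun K hK => ?_⟩
  -- J30-v1.1's engine: every term, read through `Φ`, is holomorphic on `U`
  have key : ∀ (K' : ℕ) (X : (domSys (F.P K') M (k + 1)).Dom),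
      DifferentiableOn ℂ (fun z' => ((S K') k).E (histPrefix g k) (Φ K' k X z') X) (U K' k X) := fun K' X =>
    (differentiableOn_and_norm_clusterStepE_comp_le_of_activityHol F K' ((S K') k) (Wk K' k) (sp K' k) hA hr₁ hrate hsmall (h238 K' k) (hWk g hg K' k) X
      (Φ K' k X) (hU K' k X) (hHhol K' k _ (hWk g hg K' k) X) (hΦsp K' k X)).1
  -- the chart clause: def-B's exponential chart of a term is the term read through `Φ ∘ ιc`
  have hf : ∀ (K' : ℕ) (X : (domSys (F.P K') M (k + 1)).Dom) (B : Fin (F.P K').d → Site (F.P K') (k + 1) → V),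
      expChart (fun U' => (((S K') k).E (histPrefix g k) (emb K' k U') X).re) ρ B = (((S K') k).E (histPrefix g k) (Φ K' k X (ιc K' k X B)) X).re :=
    fun K' X B => by rw [B12PolarizationTensor120.expChart_apply, hΦemb]
  have h0U : ∀ (K' : ℕ) (X : (domSys (F.P K') M (k + 1)).Dom), (0 : Ec K' k) ∈ U K' k X := fun K' X => hrU K' k X (mem_ball_self hr)
  -- the one-bond directions have complexified norm `≤ B₃` (site weights under the p. 282 tail profile)
  have hιB : ∀ (K' : ℕ) (X : (domSys (F.P K') M (k + 1)).Dom) (l : Fin (F.P K').d) (t : Site (F.P K') (k + 1)) (c : ι),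
      ‖ιc K' k X (Pi.single l (Pi.single t (bV c)))‖ ≤ B₃ := fun K' X l t c => by
    refine (hw K' k X l t c).trans ((hwB K' k X t).trans (mul_le_of_le_one_right hB₃ (Real.exp_le_one_iff.2 ?_)))
    exact mul_nonpos_of_nonpos_of_nonneg (neg_nonpos.2 hδ₀.le) (distCT_nonneg _ _)
  -- the two-point complex generating functions of the two volumes
  set gA : ι → (Fin 2 → ℂ) → ℂ := fun c σ => ∑ X ∈ Finset.univ.filter (lo k (K + 1)), ((S (K + 1)) k).E (histPrefix g k) (Φ (K + 1) k X
      (σ 0 • ιc (K + 1) k X (Pi.single (Fin.cast (F.P_d (K + 1)).symm μ) (Pi.single (siteOfInt F (K + 1) (k + 1) z) (bV c))) +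
       σ 1 • ιc (K + 1) k X (Pi.single (Fin.cast (F.P_d (K + 1)).symm ν) (Pi.single (siteOfInt F (K + 1) (k + 1) 0) (bV c))))) X with hgA
  set gB : ι → (Fin 2 → ℂ) → ℂ := fun c σ => ∑ X ∈ Finset.univ.filter (lo k K), ((S K) k).E (histPrefix g k) (Φ K k X
      (σ 0 • ιc K k X (Pi.single (Fin.cast (F.P_d K).symm μ) (Pi.single (siteOfInt F K (k + 1) z) (bV c))) +
       σ 1 • ιc K k X (Pi.single (Fin.cast (F.P_d K).symm ν) (Pi.single (siteOfInt F K (k + 1) 0) (bV c))))) X with hgB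
  -- each volume: the small partial sum of kernels = the colour average of `polTensor` of the generating function (§1)
  have eA := sum_polScalar_eq_avg_polTensor_twoPointGenerating (Finset.univ.filter (lo k (K + 1)))
    (fun X U' => (((S (K + 1)) k).E (histPrefix g k) (emb (K + 1) k U') X).re) ρ bV (fun X z' => ((S (K + 1)) k).E (histPrefix g k) (Φ (K + 1) k X z') X)
    (fun X => U (K + 1) k X) (fun X => ιc (K + 1) k X) (fun X _ => hU (K + 1) k X) (fun X _ => h0U (K + 1) X) (fun X _ => key (K + 1) X) (fun X _ B => hf (K + 1) X B)
    (Fin.cast (F.P_d (K + 1)).symm μ) (siteOfInt F (K + 1) (k + 1) z) (Fin.cast (F.P_d (K + 1)).symm ν) (siteOfInt F (K + 1) (k + 1) 0) gA (fun c σ => by simp only [hgA])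
  have eB := sum_polScalar_eq_avg_polTensor_twoPointGenerating (Finset.univ.filter (lo k K))
    (fun X U' => (((S K) k).E (histPrefix g k) (emb K k U') X).re) ρ bV (fun X z' => ((S K) k).E (histPrefix g k) (Φ K k X z') X)
    (fun X => U K k X) (fun X => ιc K k X) (fun X _ => hU K k X) (fun X _ => h0U K X) (fun X _ => key K X) (fun X _ B => hf K X B)
    (Fin.cast (F.P_d K).symm μ) (siteOfInt F K (k + 1) z) (Fin.cast (F.P_d K).symm ν) (siteOfInt F K (k + 1) 0) gB (fun c σ => by simp only [hgB])
  rw [eA, eB]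
  -- holomorphy of both generating functions on the bidisc and their (G≈)-closeness there
  have hgAhol : ∀ c, DifferentiableOn ℂ (gA c) (ball 0 r₂) := fun c => by
    simp only [hgA]
    exact differentiableOn_twoPointGenerating (Finset.univ.filter (lo k (K + 1))) (fun X z' => ((S (K + 1)) k).E (histPrefix g k) (Φ (K + 1) k X z') X)
      (fun X => U (K + 1) k X) (fun X => ιc (K + 1) k X (Pi.single (Fin.cast (F.P_d (K + 1)).symm μ) (Pi.single (siteOfInt F (K + 1) (k + 1) z) (bV c))))
      (fun X => ιc (K + 1) k X (Pi.single (Fin.cast (F.P_d (K + 1)).symm ν) (Pi.single (siteOfInt F (K + 1) (k + 1) 0) (bV c))))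
      hB₃ hr₂ hr₂r (fun X _ => hrU (K + 1) k X) (fun X _ => key (K + 1) X) (fun X _ => hιB (K + 1) X _ _ c) (fun X _ => hιB (K + 1) X _ _ c)
  have hgBhol : ∀ c, DifferentiableOn ℂ (gB c) (ball 0 r₂) := fun c => by
    simp only [hgB]
    exact differentiableOn_twoPointGenerating (Finset.univ.filter (lo k K)) (fun X z' => ((S K) k).E (histPrefix g k) (Φ K k X z') X)
      (fun X => U K k X) (fun X => ιc K k X (Pi.single (Fin.cast (F.P_d K).symm μ) (Pi.single (siteOfInt F K (k + 1) z) (bV c))))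
      (fun X => ιc K k X (Pi.single (Fin.cast (F.P_d K).symm ν) (Pi.single (siteOfInt F K (k + 1) 0) (bV c))))
      hB₃ hr₂ hr₂r (fun X _ => hrU K k X) (fun X _ => key K X) (fun X _ => hιB K X _ _ c) (fun X _ => hιB K X _ _ c)
  have hη : 0 ≤ max C 0 * r₀ ^ K := mul_nonneg (le_max_right _ _) (pow_nonneg hr₀' K)
  have hclose : ∀ c, ∀ σ ∈ ball (0 : Fin 2 → ℂ) r₂, ‖gA c σ - gB c σ‖ ≤ max C 0 * r₀ ^ K := fun c σ hσ => by
    simp only [hgA, hgB]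
    exact (hC K hK c σ (mem_ball_zero_iff.1 hσ)).trans (mul_le_mul_of_nonneg_right (le_max_left C 0) (pow_nonneg hr₀' K))
  refine (abs_avg_polTensor_twoPoint_sub_le gA gB hr₂ hη hgAhol hgBhol hclose).trans (le_of_eq ?_)
  ring

end Towers


end YMDAG.N22.AtKernels

end
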